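import Summits.QuantumFields.BalabanUV.Beta.GAN24.AliasDecimate

/-!
# `BalabanUV.Beta.FP.AliasDecimateIntegrable` — road «FP» (binder row D1), row H′2-IR ∕ IR-2 leaf (i) «COARSE COVARIANCE SYMBOL», file 1∕3:
# the `L¹` TWIN of leaf-17's «ALIAS-DECIMATE*» engine — DECIMATION = ALIASING for lattice kernels whose symbol is merely INTEGRABLE on the
# real Brillouin zone (not continuous): `latticeKernel G (L•z + r) = latticeKernel (aliasSym L r G) z` and the offset-sum form, under
# «`G` globally `2π`-periodic in each coordinate ∧ `IntegrableOn (G ∘ ofRealVec) [−π,π]^{d+1}`»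

NOT IN PRINT; OUR BOOKKEEPING ([folklore] measure theory on `ℝ^{d+1}`).  WHY: the coarse covariance `C_n = Q_n P^{BF} Q_nᵀ` of road FP's
H′2-IR (owner design memo `HOME/b2b-balaban-beta-d1-p3/H2IR-DESIGN.md` §IR-2, ROW REFINEMENT «IR-2 (i)–(iii) SWARM-READY NOW», journal l.21049)
averages the MASSLESS BF-Feynman propagator, whose symbol `PinfSym s (d1Sym s)` (`FP/PerfectPropagatorSymbol`) is `~ 1∕|s|²` at the origin —
integrable on the zone for `d+1 ≥ 3` (`FP/PerfectPropagatorBound.integrableOn_PinfSym_d1Sym`) but NOT continuous; leaf-17's engine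
`GAN24/AliasTiling.setIntegral_BZ_eq_sum_alias` ∕ `GAN24/AliasDecimate.latticeKernel_decimate` asks continuity on the real zone (used only to get
integrability on the alias boxes).  This file removes that hypothesis: periodicity TRANSPORTS integrability from `[−π,π]^{d+1}` to its
`2πℤ^{d+1}`-translates, hence to the wide zone `[−π,3π]^{d+1}` which contains every alias box, and the contraction `p ↦ (p + 2πl)∕L` preserves
integrability (Mathlib `integrable_comp_smul_iff` + translation invariance).  Everything else is leaf-17's proof, re-run BY NAME.

## What is proved ([folklore], `0 sorry`, generic `d`, `L ≥ 1`; `g : ℝ^{d+1} → ℂ`, `G : ℂ^{d+1} → ℂ`)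
* §1 `integrableOn_integrand_of_integrableOn` (`G ∘ ofRealVec` integrable on the zone ⟹ every `B4ContourShift.integrand G x` is),
  `integrableOn_image_add_of_periodic` (periodic + integrable on `BZ` ⟹ integrable on `BZ + 2πk`, `k ∈ ℤ^{d+1}`), `Icc_wide_subset_iUnion`
  (`[−π,3π]^{d+1} ⊆ ⋃_{k ∈ {0,1}^{d+1}} (BZ + 2πk)`), **`integrableOn_wide_of_periodic`**.
* §2 `Icc_alo_ahi_subset_wide`, `integrableOn_abox_of_periodic`, `smul_image_add_subset_wide`, **`integrableOn_comp_apt_of_periodic`**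
  (`p ↦ g ((p + 2πl)∕L)` is integrable on the zone).
* §3 **`setIntegral_BZ_eq_sum_alias_of_integrable`**: `∫_{BZ} g = L^{−(d+1)} • Σ_l ∫_{BZ} g ∘ apt L l` for `g` periodic and integrable on `BZ`.
* §4 **`fourierBox_decimate_of_integrable`**, **`latticeKernel_decimate_of_integrable`**, `integrableOn_integrand_aliasSym_of_integrable`,
  **`latticeKernel_sum_decimate_of_integrable`** — the statements of `GAN24/AliasDecimate` §6∕§9 with `hcont` replaced by
  `hG : IntegrableOn (G ∘ ofRealVec) (BZ (d+1))`.
HONEST FRAMING: an `L¹` bookkeeping extension of a tree engine; 0 estimates of Bałaban's objects; 0∕4 row-D1 binders; NOT D1, NOT BetaPertH, NOT the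
continuum limit, NOT Clay.  HONEST DEPENDENCY (verbatim): «continuum YM on T⁴ ⇐ BetaPertH ∧ nine spine estimates (0/9 proved); BetaPertH ⇐ (D1) ∧
(D4) ∧ CAP+tail; G-an2-4 gates asym, D1 and NE2/3/4.»  ABSOLUTE RULE respected: no cited fact, no `def … : Prop`, nothing of the manuscripts asserted.
Provenance: D1 formalisation swarm leaf prover 02, gen 7 (prover-b2b-balaban-beta-d1-formalise-leaf-02-g7-0), road-FP row IR-2 (i), 2026-08-20.
-/

noncomputable section

open Complex Set MeasureTheory
open scoped Real BigOperators Pointwise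
open Literature.MathematicalPhysics.QuantumFieldTheory.Balaban1983to89
open B4Strip (ofRealVec)
open B4ContourShift (BZ phase integrand fourierBox latticeKernel norm_cexp_phase)
open Summit.QuantumFields.BalabanUV.Beta.GAN24.AliasTiling (periodic_add_intVec pbox abox alo ahi apt measurableSet_abox disjoint_abox
  abox_subset_Icc iUnion_abox setIntegral_pbox_eq_BZ setIntegral_abox_eq cast_pos_of_fin)
open Summit.QuantumFields.BalabanUV.Beta.GAN24.AliasDecimate (aliasPt aliasSym integrand_periodic integrand_aliasSym)

namespace Summit.QuantumFields.BalabanUV.Beta.FP.AliasDecimateIntegrable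

variable {d : ℕ}

/-! ## §1 Periodicity transports integrability: the wide zone `[−π, 3π]^{d+1}` -/

/-- [folklore] The zone is measurable. -/
theorem measurableSet_BZ : MeasurableSet (BZ (d + 1)) := by unfold BZ; exact measurableSet_Icc

/-- [folklore] If `G ∘ ofRealVec` is integrable on the zone, so is every lattice-kernel integrand `G(p)e^{ip·x}` (`‖e^{ip·x}‖ = 1`). -/
theorem integrableOn_integrand_of_integrableOn {G : (Fin (d + 1) → ℂ) → ℂ} (hG : IntegrableOn (fun p => G (ofRealVec p)) (BZ (d + 1)))
    (x : Fin (d + 1) → ℤ) : IntegrableOn (integrand G x) (BZ (d + 1)) := by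
  have hcont : Continuous fun p : Fin (d + 1) → ℝ => cexp (I * phase p x) := by
    unfold phase
    exact (continuous_const.mul (continuous_finsetSum _ fun μ _ =>
      (Complex.continuous_ofReal.comp (continuous_apply μ)).mul continuous_const)).cexp
  unfold integrand
  exact hG.mul_bdd (c := 1) hcont.aestronglyMeasurable (Filter.Eventually.of_forall fun p => (norm_cexp_phase p x).le)

/-- [folklore] PERIODICITY TRANSPORTS INTEGRABILITY: `g` `2π`-periodic in each coordinate and integrable on `[−π,π]^{d+1}` is integrable on the
translate `[−π,π]^{d+1} + 2πk` for every `k ∈ ℤ^{d+1}` (Lebesgue measure is translation invariant; `g ∘ (· + 2πk) = g`). -/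
theorem integrableOn_image_add_of_periodic {g : (Fin (d + 1) → ℝ) → ℂ}
    (hper : ∀ (i : Fin (d + 1)) (p : Fin (d + 1) → ℝ), g (Function.update p i (p i + 2 * π)) = g p)
    (hg : IntegrableOn g (BZ (d + 1))) (k : Fin (d + 1) → ℤ) :
    IntegrableOn g ((fun p => p + (fun i => 2 * π * (k i : ℝ))) '' BZ (d + 1)) := by
  have hmp := measurePreserving_add_right (volume : Measure (Fin (d + 1) → ℝ)) ((fun i => 2 * π * (k i : ℝ)))
  have hemb : MeasurableEmbedding (fun x : Fin (d + 1) → ℝ => x + (fun i => 2 * π * (k i : ℝ))) := (MeasurableEquiv.addRight ((fun i => 2 * π * (k i : ℝ)))).measurableEmbedding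
  have hinj : Function.Injective (fun x : Fin (d + 1) → ℝ => x + (fun i => 2 * π * (k i : ℝ))) := fun a b h => by simpa using h
  refine (hmp.integrableOn_comp_preimage hemb).1 ?_
  rw [hinj.preimage_image]
  have hcomp : (g ∘ fun x : Fin (d + 1) → ℝ => x + (fun i => 2 * π * (k i : ℝ))) = g := by
    funext p
    simp only [Function.comp_apply]
    have e : p + (fun i => 2 * π * (k i : ℝ)) = fun i => p i + 2 * π * (k i : ℝ) := by funext i; simp
    rw [e]
    exact periodic_add_intVec hper p k
  rw [hcomp]
  exact hg

/-- [folklore] THE WIDE ZONE IS COVERED BY `2^{d+1}` TRANSLATES OF THE ZONE: `[−π,3π]^{d+1} ⊆ ⋃_{k ∈ {0,1}^{d+1}} ([−π,π]^{d+1} + 2πk)`. -/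
theorem Icc_wide_subset_iUnion :
    Icc (fun _ : Fin (d + 1) => -π) (fun _ => 3 * π) ⊆
      ⋃ k : Fin (d + 1) → Fin 2, (fun p => p + (fun i => 2 * π * ((k i : ℕ) : ℝ))) '' BZ (d + 1) := by
  intro p hp
  rw [Set.mem_Icc] at hp
  set k : Fin (d + 1) → Fin 2 := fun i => if p i ≤ π then 0 else 1 with hk
  refine Set.mem_iUnion.mpr ⟨k, ?_⟩
  refine ⟨p - (fun i => 2 * π * ((k i : ℕ) : ℝ)), ?_, by simp⟩
  unfold BZ
  rw [Set.mem_Icc]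
  constructor
  · intro i
    have h1 := hp.1 i
    simp only [Pi.sub_apply, hk]
    split_ifs with h
    · simp; linarith
    · push Not at h; simp; linarith
  · intro i
    have h2 := hp.2 i
    simp only [Pi.sub_apply, hk]
    split_ifs with h
    · simp; linarith
    · simp; linarith

/-- [folklore] **INTEGRABILITY ON THE WIDE ZONE**: `g` periodic and integrable on `[−π,π]^{d+1}` is integrable on `[−π,3π]^{d+1}`. -/
theorem integrableOn_wide_of_periodic {g : (Fin (d + 1) → ℝ) → ℂ}
    (hper : ∀ (i : Fin (d + 1)) (p : Fin (d + 1) → ℝ), g (Function.update p i (p i + 2 * π)) = g p)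
    (hg : IntegrableOn g (BZ (d + 1))) : IntegrableOn g (Icc (fun _ : Fin (d + 1) => -π) (fun _ => 3 * π)) :=
  (integrableOn_finite_iUnion.mpr fun _ => integrableOn_image_add_of_periodic hper hg _).mono_set Icc_wide_subset_iUnion

/-! ## §2 Alias boxes lie in the wide zone; the contraction `p ↦ (p + 2πl)/L` preserves integrability -/

section Boxes

variable (L : ℕ) [NeZero L]

/-- [folklore] The closed alias box `∏_i [((2l_i−1)π)/L, ((2l_i+1)π)/L]` lies in the wide zone `[−π, 3π]^{d+1}`. -/
theorem Icc_alo_ahi_subset_wide (l : Fin (d + 1) → Fin L) :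
    Icc (alo L l) (ahi L l) ⊆ Icc (fun _ : Fin (d + 1) => -π) (fun _ => 3 * π) := by
  have hL : (0 : ℝ) < L := cast_pos_of_fin L l
  have hL1 : (1 : ℝ) ≤ L := by exact_mod_cast Nat.pos_of_ne_zero (NeZero.ne L)
  intro p hp
  rw [Set.mem_Icc] at hp ⊢
  constructor
  · intro i
    have h := hp.1 i
    have hl0 : (0 : ℝ) ≤ ((l i : ℕ) : ℝ) := by positivity
    have ha : -π ≤ alo L l i := by
      simp only [alo]
      rw [le_div_iff₀ hL]
      nlinarith [Real.pi_pos]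
    exact ha.trans h
  · intro i
    have h := hp.2 i
    have hl1 : ((l i : ℕ) : ℝ) + 1 ≤ L := by exact_mod_cast (l i).isLt
    have hb : ahi L l i ≤ 3 * π := by
      simp only [ahi]
      rw [div_le_iff₀ hL]
      nlinarith [Real.pi_pos]
    exact h.trans hb

/-- [folklore] A periodic function integrable on the zone is integrable on every alias box. -/
theorem integrableOn_abox_of_periodic {g : (Fin (d + 1) → ℝ) → ℂ}
    (hper : ∀ (i : Fin (d + 1)) (p : Fin (d + 1) → ℝ), g (Function.update p i (p i + 2 * π)) = g p)
    (hg : IntegrableOn g (BZ (d + 1))) (l : Fin (d + 1) → Fin L) : IntegrableOn g (abox L l) :=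
  (integrableOn_wide_of_periodic hper hg).mono_set ((abox_subset_Icc L l).trans (Icc_alo_ahi_subset_wide L l))

/-- [folklore] The contracted translated zone `L⁻¹ • ([−π,π]^{d+1} + 2πl)` lies in the wide zone (indeed in `[−π/L, (2L−1)π/L]^{d+1}`). -/
theorem smul_image_add_subset_wide (l : Fin (d + 1) → Fin L) :
    (L : ℝ)⁻¹ • ((fun p => p + (fun i => 2 * π * ((l i : ℕ) : ℝ))) '' BZ (d + 1)) ⊆ Icc (fun _ : Fin (d + 1) => -π) (fun _ => 3 * π) := by
  have hL : (0 : ℝ) < L := cast_pos_of_fin L l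
  have hL1 : (1 : ℝ) ≤ L := by exact_mod_cast Nat.pos_of_ne_zero (NeZero.ne L)
  rintro y ⟨q, ⟨p, hp, rfl⟩, rfl⟩
  unfold BZ at hp
  rw [Set.mem_Icc] at hp ⊢
  constructor
  · intro i
    have h := hp.1 i
    have hl0 : (0 : ℝ) ≤ ((l i : ℕ) : ℝ) := by positivity
    simp only [Pi.smul_apply, Pi.add_apply, smul_eq_mul]
    rw [← div_eq_inv_mul, le_div_iff₀ hL]
    nlinarith [Real.pi_pos]
  · intro i
    have h := hp.2 i
    have hl1 : ((l i : ℕ) : ℝ) + 1 ≤ L := by exact_mod_cast (l i).isLt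
    simp only [Pi.smul_apply, Pi.add_apply, smul_eq_mul]
    rw [← div_eq_inv_mul, div_le_iff₀ hL]
    nlinarith [Real.pi_pos]

/-- [folklore] **THE CONTRACTION PRESERVES INTEGRABILITY**: for `g` periodic and integrable on the zone, `p ↦ g ((p + 2πl)/L)` is integrable on the
zone (translation invariance + `integrable_comp_smul_iff` for the dilation by `L⁻¹`, against integrability of `g` on the wide zone). -/
theorem integrableOn_comp_apt_of_periodic {g : (Fin (d + 1) → ℝ) → ℂ}
    (hper : ∀ (i : Fin (d + 1)) (p : Fin (d + 1) → ℝ), g (Function.update p i (p i + 2 * π)) = g p)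
    (hg : IntegrableOn g (BZ (d + 1))) (l : Fin (d + 1) → Fin L) :
    IntegrableOn (fun p => g (apt L l p)) (BZ (d + 1)) := by
  have hL : (0 : ℝ) < L := cast_pos_of_fin L l
  set c : Fin (d + 1) → ℝ := (fun i => 2 * π * ((l i : ℕ) : ℝ)) with hc
  set S : Set (Fin (d + 1) → ℝ) := (fun p => p + c) '' BZ (d + 1) with hS
  -- integrability of `g` on the contracted translated zone
  have hgS : IntegrableOn g ((L : ℝ)⁻¹ • S) := (integrableOn_wide_of_periodic hper hg).mono_set (smul_image_add_subset_wide L l)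
  -- the dilation: `q ↦ g (L⁻¹ • q)` is integrable on `S`
  have hmeasS : MeasurableSet S := by
    rw [hS]; exact (MeasurableEquiv.addRight c).measurableEmbedding.measurableSet_image.mpr measurableSet_BZ
  have hmeasS' : MeasurableSet ((L : ℝ)⁻¹ • S) := hmeasS.const_smul₀ _
  have hdil : IntegrableOn (fun q => g ((L : ℝ)⁻¹ • q)) S := by
    rw [← integrable_indicator_iff hmeasS]
    have hind : S.indicator (fun q => g ((L : ℝ)⁻¹ • q)) = fun q => ((L : ℝ)⁻¹ • S).indicator g ((L : ℝ)⁻¹ • q) := by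
      funext q
      by_cases hq : q ∈ S
      · rw [Set.indicator_of_mem hq, Set.indicator_of_mem (Set.smul_mem_smul_set hq)]
      · rw [Set.indicator_of_notMem hq, Set.indicator_of_notMem]
        intro h
        exact hq ((Set.smul_mem_smul_set_iff₀ (inv_ne_zero hL.ne') S q).mp h)
    rw [hind, integrable_comp_smul_iff volume (((L : ℝ)⁻¹ • S).indicator g) (inv_ne_zero hL.ne'), integrable_indicator_iff hmeasS']
    exact hgS
  -- the translation
  have hmp := measurePreserving_add_right (volume : Measure (Fin (d + 1) → ℝ)) c
  have hemb : MeasurableEmbedding (fun x : Fin (d + 1) → ℝ => x + c) := (MeasurableEquiv.addRight c).measurableEmbedding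
  have hinj : Function.Injective (fun x : Fin (d + 1) → ℝ => x + c) := fun a b h => by simpa using h
  have h1 := (hmp.integrableOn_comp_preimage hemb (f := fun q => g ((L : ℝ)⁻¹ • q)) (s := S)).2 hdil
  rw [hS, hinj.preimage_image] at h1
  refine h1.congr_fun (fun p _ => ?_) measurableSet_BZ
  simp only [Function.comp_apply]
  congr 1
  funext i
  simp only [Pi.smul_apply, Pi.add_apply, smul_eq_mul, apt, hc, div_eq_inv_mul]

end Boxes

/-! ## §3 The zone integral of a periodic INTEGRABLE function is the alias average of its contracted translates -/

/-- [folklore] **DECIMATION = ALIASING, pure `L¹` form**: for `g : ℝ^{d+1} → ℂ` `2π`-periodic in each coordinate and integrable on `[−π,π]^{d+1}`,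
`∫_{[−π,π]^{d+1}} g(k) dk = L^{−(d+1)} Σ_{l ∈ {0,…,L−1}^{d+1}} ∫_{[−π,π]^{d+1}} g((p + 2πl)/L) dp` (leaf-17's `AliasTiling.setIntegral_BZ_eq_sum_alias`
with continuity weakened to integrability). -/
theorem setIntegral_BZ_eq_sum_alias_of_integrable (L : ℕ) [NeZero L] (g : (Fin (d + 1) → ℝ) → ℂ)
    (hper : ∀ (i : Fin (d + 1)) (p : Fin (d + 1) → ℝ), g (Function.update p i (p i + 2 * π)) = g p)
    (hg : IntegrableOn g (BZ (d + 1))) :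
    ∫ k in BZ (d + 1), g k = (((L : ℝ) ^ (d + 1))⁻¹ : ℝ) • ∑ l : Fin (d + 1) → Fin L, ∫ p in BZ (d + 1), g (apt L l p) := by
  have hF : ∀ (p : Fin (d + 1) → ℝ) (k : Fin (d + 1) → ℤ), g (fun i => p i + 2 * π * k i) = g p := periodic_add_intVec hper
  rw [← setIntegral_pbox_eq_BZ g hF (fun _ => -(π / L)), ← iUnion_abox L]
  have hU : (⋃ l, abox L l) = ⋃ l ∈ (Finset.univ : Finset (Fin (d + 1) → Fin L)), abox L l := by simp
  rw [hU, integral_biUnion_finset Finset.univ (fun l _ => measurableSet_abox L l) (fun l _ l' _ h => disjoint_abox L h)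
      (fun l _ => integrableOn_abox_of_periodic L hper hg l)]
  rw [Finset.smul_sum]
  exact Finset.sum_congr rfl fun l _ => setIntegral_abox_eq L g l

/-! ## §4 `L¹` decimation for `fourierBox` ∕ `latticeKernel` and the offset-sum form -/

section Decimate

variable (L : ℕ) [NeZero L]

/-- [folklore] **DECIMATION = ALIASING FOR THE FOURIER BOX INTEGRAL, `L¹` form**: for `G` globally `2π`-periodic in each coordinate with
`G ∘ ofRealVec` integrable on the zone, `∫_{BZ} G(k) e^{ik·(L•z + r)} dk = ∫_{BZ} (aliasSym L r G)(p) e^{ip·z} dp`. -/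
theorem fourierBox_decimate_of_integrable {G : (Fin (d + 1) → ℂ) → ℂ}
    (hper : ∀ (i : Fin (d + 1)) (P : Fin (d + 1) → ℂ), G (Function.update P i (P i + 2 * π)) = G P)
    (hG : IntegrableOn (fun p => G (ofRealVec p)) (BZ (d + 1))) (z r : Fin (d + 1) → ℤ) :
    fourierBox G ((L : ℤ) • z + r) = fourierBox (aliasSym L r G) z := by
  have hgi : IntegrableOn (integrand G ((L : ℤ) • z + r)) (BZ (d + 1)) := integrableOn_integrand_of_integrableOn hG _
  unfold fourierBox
  rw [setIntegral_BZ_eq_sum_alias_of_integrable L (integrand G ((L : ℤ) • z + r)) (integrand_periodic hper _) hgi]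
  have hint : ∀ l : Fin (d + 1) → Fin L, IntegrableOn (fun p => integrand G ((L : ℤ) • z + r) (apt L l p)) (BZ (d + 1)) :=
    fun l => integrableOn_comp_apt_of_periodic L (integrand_periodic hper _) hgi l
  symm
  calc ∫ p in BZ (d + 1), integrand (aliasSym L r G) z p
      = ∫ p in BZ (d + 1), (((L : ℝ) ^ (d + 1))⁻¹ : ℝ) • ∑ l : Fin (d + 1) → Fin L, integrand G ((L : ℤ) • z + r) (apt L l p) :=
        integral_congr_ae (Filter.Eventually.of_forall fun p => integrand_aliasSym L G r z p)
    _ = (((L : ℝ) ^ (d + 1))⁻¹ : ℝ) • ∑ l : Fin (d + 1) → Fin L, ∫ p in BZ (d + 1), integrand G ((L : ℤ) • z + r) (apt L l p) := by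
        rw [integral_smul, integral_finsetSum _ fun l _ => hint l]

/-- [folklore] **DECIMATION = ALIASING FOR LATTICE KERNELS, `L¹` form**: `latticeKernel G (L•z + r) = latticeKernel (aliasSym L r G) z`. -/
theorem latticeKernel_decimate_of_integrable {G : (Fin (d + 1) → ℂ) → ℂ}
    (hper : ∀ (i : Fin (d + 1)) (P : Fin (d + 1) → ℂ), G (Function.update P i (P i + 2 * π)) = G P)
    (hG : IntegrableOn (fun p => G (ofRealVec p)) (BZ (d + 1))) (z r : Fin (d + 1) → ℤ) :
    latticeKernel G ((L : ℤ) • z + r) = latticeKernel (aliasSym L r G) z := by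
  unfold latticeKernel
  rw [fourierBox_decimate_of_integrable L hper hG z r]

/-- [folklore] The integrand of the aliased symbol is integrable on the zone (it is the alias average of integrable contracted translates). -/
theorem integrableOn_integrand_aliasSym_of_integrable {G : (Fin (d + 1) → ℂ) → ℂ}
    (hper : ∀ (i : Fin (d + 1)) (P : Fin (d + 1) → ℂ), G (Function.update P i (P i + 2 * π)) = G P)
    (hG : IntegrableOn (fun p => G (ofRealVec p)) (BZ (d + 1))) (r z : Fin (d + 1) → ℤ) :
    IntegrableOn (integrand (aliasSym L r G) z) (BZ (d + 1)) := by
  have hgi : IntegrableOn (integrand G ((L : ℤ) • z + r)) (BZ (d + 1)) := integrableOn_integrand_of_integrableOn hG _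
  have hint : ∀ l : Fin (d + 1) → Fin L, IntegrableOn (fun p => integrand G ((L : ℤ) • z + r) (apt L l p)) (BZ (d + 1)) :=
    fun l => integrableOn_comp_apt_of_periodic L (integrand_periodic hper _) hgi l
  have hsum : IntegrableOn (fun p => (((L : ℝ) ^ (d + 1))⁻¹ : ℝ) • ∑ l : Fin (d + 1) → Fin L, integrand G ((L : ℤ) • z + r) (apt L l p))
      (BZ (d + 1)) := by
    have h := integrable_finsetSum (μ := volume.restrict (BZ (d + 1))) Finset.univ (fun l _ => hint l)
    exact h.smul ((((L : ℝ) ^ (d + 1))⁻¹ : ℝ))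
  refine hsum.congr_fun (fun p _ => ?_) measurableSet_BZ
  exact (integrand_aliasSym L G r z p).symm

/-- [folklore] **OFFSET SUMS, `L¹` form**: `Σ_{a ∈ R} w_a · latticeKernel G (L•z + r_a) = latticeKernel (P ↦ Σ_{a ∈ R} w_a · aliasSym L r_a G P) z`. -/
theorem latticeKernel_sum_decimate_of_integrable {ι : Type*} (R : Finset ι) (w : ι → ℂ) (r : ι → Fin (d + 1) → ℤ)
    {G : (Fin (d + 1) → ℂ) → ℂ}
    (hper : ∀ (i : Fin (d + 1)) (P : Fin (d + 1) → ℂ), G (Function.update P i (P i + 2 * π)) = G P)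
    (hG : IntegrableOn (fun p => G (ofRealVec p)) (BZ (d + 1))) (z : Fin (d + 1) → ℤ) :
    ∑ a ∈ R, w a * latticeKernel G ((L : ℤ) • z + r a) = latticeKernel (fun P => ∑ a ∈ R, w a * aliasSym L (r a) G P) z := by
  rw [B4Green244.latticeKernel_sum_mul R w (fun a => aliasSym L (r a) G) z
    (fun a _ => integrableOn_integrand_aliasSym_of_integrable L hper hG (r a) z)]
  exact Finset.sum_congr rfl fun a _ => by rw [latticeKernel_decimate_of_integrable L hper hG z (r a)]

end Decimate

end Summit.QuantumFields.BalabanUV.Beta.FP.AliasDecimateIntegrable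

end
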